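import Summits.QuantumFields.BalabanUV.T4Continuum.Support.NE4GaussianCouplingTwoPoint

/-!
# NE4GaussianCouplingTwoPointWitness — NON-VACUITY of `NE4GaussianCouplingTwoPoint.couplingTwoPoint_of_gaussian`: the
# constant ONE-BOND Gaussian family meets every displayed hypothesis of the production theorem, so the bridge's COUPLING
# TWO-POINT clause it produces is inhabited by a coupling-dependent activity (cell `pub-balaban`, T⁴-continuum fan-out,
# `HOME/BINDER-OWNERS.md` row NE4 = node U2, owner lineage t4-ne4-p1, generation 33; a model certificate, NOT a statement
# about Bałaban's functionals)

HONEST FRAMING (T4-DAG PAGE 1).  Rung (B)+1 on a FIXED finite torus — NOT infinite volume, NOT a mass gap, NOT the Clay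
problem.  NE9 and NE4 are cell NEW ESTIMATES, NOT PRINTED, NOT PROVED; 0/9 unchanged by this module.  This module is a TOY:
the standard Gaussian on `ℝ¹` (`EuclideanSpace ℝ (Fin 1)`), one small-field bond, no tables.  It asserts NOTHING about
[Balaban1988RG2Cluster]; no quotation is introduced; `FlowStep.BetaPertH`, (B), (B^μ) do not occur.

WHAT THIS MODULE IS.  The production theorem `NE4GaussianCouplingTwoPoint.couplingTwoPoint_of_gaussian` (p205029) carries,
per index (step, background, old terms, polymer), some twenty-five displayed binders (tilt admissibility, measurability,
signs, link, analyticity, coupling factors, box bounds, dilated box bounds, two dominations, two comparisons with the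
common majorant) plus the index class, the displayed Gaussian model `hact`, the t-floor and the scalars.  A theorem with that
many hypotheses is only worth its conclusion if the hypotheses are JOINTLY SATISFIABLE.  Here they are met, over ARBITRARY
carriers / cluster geometry / backgrounds / old terms / admissible classes and for arbitrary scalars `0 ≤ ε₁`, `0 < c`,
`0 < γ`, by the CONSTANT family whose every index carries the one-bond datum (§1 `oneBondAct`: `T = id` on `ℝ¹`, small-field
bond `e₀`, `lb = ab = ∅`, `terms = ∅`, prefactor `1`, `e = e₁ = 0`, `α = 0`, `h = 0`, `M₀ = 1`, `M₁ = 0`), with the common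
majorant `n = 1` and the modulus ratio `clip = ε₁γ/√(2π)` — the two comparisons hold with `Π = Π_i tiltConst 0 0 = 1` and
`‖Te₀‖ = 1` (size `1 ≤ 1`; modulus `0 + (2ε₁/√(2π))·(γ/2) = ε₁γ/√(2π)`).  §1 `oneBondAct_eq` computes the activity in
closed form, `𝒩(|⟨e₀, z⟩| < ε₁√t)` — it moves with `t`, so the witnessed clause is not about a constant.  §2
`couplingTwoPoint_oneBond_witness` is the production theorem APPLIED to this family: the bridge's clause for `oneBondAct ε₁`
on the t-box `[γ⁻², ∞[` (size `≤ 1`, modulus `≤ (ε₁γ/√(2π))·|t − t′|·1`).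

WHAT IS PROVED: the above, kernel-checked; 0 sorry; axioms ⊆ {propext, Classical.choice, Quot.sound}; imports
`Support/NE4GaussianCouplingTwoPoint` (p205029) only, modifies nothing.  ONE definition (`oneBondAct`, the toy activity; no
`Prop`-valued definition, nothing hidden).  NOT COVERED: anything about Bałaban's objects; the comparisons with the
(2.38)-majorant for them; NE9, NE5, NE4.  NOT summit progress.
-/

noncomputable section

namespace Summit.QuantumFields.BalabanUV.T4Continuum.NE4GaussianCouplingTwoPointWitness

open MeasureTheory ProbabilityTheory
open scoped BigOperators RealInnerProductSpace
open Literature.MathematicalPhysics.QuantumFieldTheory.Balaban1983to89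
open T4OutputRate (Carriers)
open T4HistoryLipschitzActivity (ClusterGeom)
open NE9CouplingTwoPoint (formAct)
open NE9LocalTwoPoint (cutoffLF)
open NE9DilatedTables (smallFieldPolydisc dilationDomain dilTables)
open NE9TiltedProduct (tiltConst)
open NE4GaussianCouplingTwoPoint (couplingTwoPoint_of_gaussian)

variable {C : Carriers}

/-! ## §1 The one-bond Gaussian activity and its closed form -/

/-- The ONE-BOND (2.14)-form Gaussian activity at the coupling `s = (√t)⁻¹` of a t-coordinate: fluctuation space `ℝ¹` with
the standard Gaussian, ONE small-field bond with unit functional `z ↦ ⟨e₀, z⟩` and threshold `ε₁/s`, no large-field bond,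
prefactor `1`, no tables (the (2.12) sum over `terms = ∅`).  A toy; nothing of Bałaban's construction. [folklore] -/
def oneBondAct (ε₁ t : ℝ) : ℂ :=
  formAct (stdGaussian (EuclideanSpace ℝ (Fin 1)))
    (cutoffLF ({()} : Finset Unit) (∅ : Finset Unit)
      (fun _ (z : EuclideanSpace ℝ (Fin 1)) => ⟪EuclideanSpace.single (0 : Fin 1) (1 : ℝ), z⟫) ε₁)
    (fun _ => (1 : ℂ))
    (fun x z => dilTables (∅ : Finset Unit) (fun _ _ => (0 : ℂ)) (fun _ (_ : ℂ) => (0 : ℂ)) (fun _ => (0 : ℂ)) x z)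
    (Real.sqrt t)⁻¹

/-- The one-bond activity IS the standard Gaussian mass of the small-field window `|⟨e₀, z⟩| < ε₁·√t`: a number that moves
with `t` — the produced clause below is about a genuinely coupling-dependent activity. [folklore] -/
theorem oneBondAct_eq (ε₁ t : ℝ) :
    oneBondAct ε₁ t = ((stdGaussian (EuclideanSpace ℝ (Fin 1))).real
      {z | |⟪EuclideanSpace.single (0 : Fin 1) (1 : ℝ), z⟫| < ε₁ * Real.sqrt t} : ℂ) := by
  have hset : cutoffLF ({()} : Finset Unit) (∅ : Finset Unit)
      (fun _ (z : EuclideanSpace ℝ (Fin 1)) => ⟪EuclideanSpace.single (0 : Fin 1) (1 : ℝ), z⟫) ε₁ (Real.sqrt t)⁻¹ =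
      {z | |⟪EuclideanSpace.single (0 : Fin 1) (1 : ℝ), z⟫| < ε₁ * Real.sqrt t} := by
    ext z
    simp [cutoffLF, div_eq_mul_inv, inv_inv]
  have hmeas : MeasurableSet
      {z : EuclideanSpace ℝ (Fin 1) | |⟪EuclideanSpace.single (0 : Fin 1) (1 : ℝ), z⟫| < ε₁ * Real.sqrt t} :=
    measurableSet_lt (continuous_const.inner continuous_id).measurable.abs measurable_const
  unfold oneBondAct formAct
  rw [hset]
  simp only [dilTables, Finset.sum_empty, Complex.exp_zero, mul_one]
  rw [integral_indicator_const _ hmeas, Complex.real_smul, mul_one]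

/-! ## §2 The witness: every hypothesis of `couplingTwoPoint_of_gaussian` met by the constant one-bond family -/

/-- **NON-VACUITY OF `NE4GaussianCouplingTwoPoint.couplingTwoPoint_of_gaussian` (kernel).**  Over ANY carriers, cluster
geometry, backgrounds, old terms and admissible classes, and for ANY scalars `0 ≤ ε₁`, `0 < c`, `0 < γ`, the CONSTANT
family carrying at every index the ONE-BOND Gaussian datum of §1 — covariance root `T = id`, small-field bonds `{e₀}`, no
large-field and no polydisc bonds, `terms = ∅`, coupling factors and tables `0`, prefactor `1`, box bounds `0`, tilt `α = 0`,
`h = 0`, `M₀ = 1`, `M₁ = 0`, index class `Idx = True`, window = the t-box `[γ⁻², ∞[` — meets ALL displayed hypotheses of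
the production theorem with the common majorant `n = 1` and the modulus ratio `clip = ε₁γ/√(2π)` (the two comparisons hold
with `Π = 1`, `‖Te₀‖ = 1`: size `1·1 ≤ 1`, modulus `0 + (1·1·2ε₁/√(2π))·(γ/2) ≤ ε₁γ/√(2π)`), whence BY THAT THEOREM the bridge's
COUPLING TWO-POINT clause for the activity `oneBondAct ε₁` on the t-box: size `≤ 1`, modulus
`≤ (ε₁γ/√(2π))·|t − t′|·1`.  So the hypothesis list of `couplingTwoPoint_of_gaussian` is jointly satisfiable, by a
coupling-dependent activity (§1); nothing about Bałaban's functionals is asserted. [folklore] -/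
theorem couplingTwoPoint_oneBond_witness (G : ClusterGeom C) {Bg : Type} {Pot : Type*} (𝒜 : ℕ → Set Pot)
    {ε₁ c γ : ℝ} (hε : 0 ≤ ε₁) (hc : 0 < c) (hγ : 0 < γ) :
    ∀ g ∈ {g : ℕ → ℝ | ∀ k, (γ ^ 2)⁻¹ ≤ g k}, ∀ g' ∈ {g : ℕ → ℝ | ∀ k, (γ ^ 2)⁻¹ ≤ g k},
      ∀ (k : ℕ) (U : Bg) (X : C.Dom), C.scale X = k + 1 → ∀ Q ∈ 𝒜 k, ∀ p ∈ G.vol X,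
        ‖(fun (_ : ℕ) (t : ℝ) (_ : Bg) (_ : Pot) (_ : G.P) => oneBondAct ε₁ t) k (g k) U Q p‖ ≤
            (fun (_ : ℕ) (_ : ℝ) (_ : Bg) (_ : G.P) => (1 : ℝ)) k (g' k) U p ∧
          ‖(fun (_ : ℕ) (t : ℝ) (_ : Bg) (_ : Pot) (_ : G.P) => oneBondAct ε₁ t) k (g k) U Q p -
              (fun (_ : ℕ) (t : ℝ) (_ : Bg) (_ : Pot) (_ : G.P) => oneBondAct ε₁ t) k (g' k) U Q p‖ ≤
            (fun _ : ℕ => ε₁ * γ / Real.sqrt (2 * Real.pi)) k * |g k - g' k| *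
              (fun (_ : ℕ) (_ : ℝ) (_ : Bg) (_ : G.P) => (1 : ℝ)) k (g' k) U p := by
  set v : EuclideanSpace ℝ (Fin 1) := EuclideanSpace.single (0 : Fin 1) (1 : ℝ) with hv
  have hvn : ‖v‖ = 1 := by simp [hv]
  have hv0 : (LinearMap.id : EuclideanSpace ℝ (Fin 1) →ₗ[ℝ] EuclideanSpace ℝ (Fin 1)) v ≠ 0 := by
    rw [LinearMap.id_apply, ← norm_ne_zero_iff, hvn]; exact one_ne_zero
  have hT : ∀ (_ : ℕ) (_ : Bg) (_ : G.P),
      (LinearMap.id : EuclideanSpace ℝ (Fin 1) →ₗ[ℝ] EuclideanSpace ℝ (Fin 1)).IsSymmetric :=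
    fun _ _ _ => LinearMap.IsSymmetric.id
  have hn : ∀ _ : G.P, Module.finrank ℝ (EuclideanSpace ℝ (Fin 1)) = 1 := fun _ => finrank_euclideanSpace_fin
  have hPt : ∀ (k : ℕ) (U : Bg) (p : G.P),
      ∏ i, tiltConst ((0 : ℝ) * ((hT k U p).eigenvalues (hn p) i) ^ 2)
        ((hT k U p).eigenvalues (hn p) i * ⟪(0 : EuclideanSpace ℝ (Fin 1)), (hT k U p).eigenvectorBasis (hn p) i⟫) = 1 := by
    intro k U p
    simp [tiltConst]
  exact couplingTwoPoint_of_gaussian G (Bg := Bg) (Pot := Pot) (ED := fun _ => EuclideanSpace ℝ (Fin 1))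
    (TT := fun _ _ _ => LinearMap.id) hT (nD := fun _ => 1) hn (Bd := fun _ => Unit)
    (sb := fun _ => ({()} : Finset Unit)) (lb := fun _ => (∅ : Finset Unit)) (ab := fun _ => (∅ : Finset Unit))
    (fun _ _ _ _ => v) (Wc := fun _ => ℂ) (Vc := ℂ) (φc := fun _ _ _ _ => (0 : ℂ)) (ℓ := fun _ _ => 0) (TM := Unit)
    (terms := fun _ => (∅ : Finset Unit)) (ac := fun _ _ => (0 : ℂ)) (F := fun _ _ _ _ _ (_ : ℂ) => (0 : ℂ))
    (pre := fun _ _ _ _ _ => (1 : ℂ)) (e := fun _ _ _ _ _ => (0 : ℝ)) (e₁ := fun _ _ _ _ _ => (0 : ℝ))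
    (hh := fun _ _ _ _ => (0 : EuclideanSpace ℝ (Fin 1))) (α := fun _ _ _ _ => (0 : ℝ)) (M₀ := fun _ _ _ _ => (1 : ℝ))
    (M₁ := fun _ _ _ _ => (0 : ℝ)) (ε₁ := ε₁) (c := c) (γ := γ) (𝒜 := 𝒜) (Idx := fun _ _ _ _ => True)
    (Wt := {g : ℕ → ℝ | ∀ k, (γ ^ 2)⁻¹ ≤ g k}) (act := fun _ t _ _ _ => oneBondAct ε₁ t)
    (n := fun _ _ _ _ => (1 : ℝ)) (clip := fun _ => ε₁ * γ / Real.sqrt (2 * Real.pi))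
    (fun _ _ _ _ _ _ _ _ => trivial) (fun _ _ _ _ _ => rfl) (fun g hg k => hg k) hε hc hγ
    (fun _ => Finset.empty_subset _) (fun _ _ _ _ _ _ _ => differentiableOn_const 0)
    (fun _ _ _ _ _ => le_rfl) (fun _ _ _ _ _ i => by rw [zero_mul]; exact zero_lt_one)
    (fun _ _ _ _ _ b _ => hv0) (fun _ _ _ _ _ => measurable_const) (fun _ _ _ _ _ => measurable_const)
    (fun _ _ _ _ _ => measurable_const)
    (fun _ _ _ _ _ s _ _ => by simp only [dilTables, Finset.sum_empty]; exact aestronglyMeasurable_const)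
    (fun _ _ _ _ _ _ => le_rfl) (fun _ _ _ _ _ => zero_le_one) (fun _ _ _ _ _ => le_rfl)
    (fun _ _ _ _ _ _ b hb => absurd hb (Finset.notMem_empty _))
    (fun _ _ _ _ _ m hm => absurd hm (Finset.notMem_empty _)) (fun _ _ _ _ _ s _ _ z _ => by simp [dilTables])
    (fun _ _ _ _ _ s s' _ _ _ _ z _ ζ _ => by simp [dilTables]) (fun _ _ _ _ _ z => by simp) (fun _ _ _ _ _ z => by simp)
    (fun k U Q p _ t' _ => by rw [hPt k U p, mul_one])
    (fun k U Q p _ t' _ => by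
      rw [hPt k U p]
      simp only [zero_mul, mul_zero, zero_div, zero_add, Finset.union_empty, Finset.sum_singleton, mul_one, one_mul,
        LinearMap.id_apply, hvn, one_pow]
      apply le_of_eq
      have hπ : 0 < Real.sqrt (2 * Real.pi) := Real.sqrt_pos.2 (by positivity)
      field_simp)

end Summit.QuantumFields.BalabanUV.T4Continuum.NE4GaussianCouplingTwoPointWitness

end
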